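import Mathlib
import HarnessLib
import Literature.Computability.AlgebraicComplexity.NilCoxeterTensor
import Literature.Computability.AlgebraicComplexity.FlatteningBound
import Literature.Computability.AlgebraicComplexity.BigCwOmegaBoundSharp
import Summits.MatrixMultiplication.MatrixMultiplication.Theses.NilCoxeterShadow
import Summits.MatrixMultiplication.MatrixMultiplication.Theorems.NilCoxeterShadowOmegaTwoGroupAlgebraRank
import Summits.MatrixMultiplication.MatrixMultiplication.Theorems.NilCoxeterShadowAThesisOfInductiveCosetGrowth

/-!
# The exponent window of the nil-Coxeter shadow: `AThesis` / `InductiveCosetGrowth` with exponent `δ`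
force `ω(ℂ) ≥ 2 + 2δ` (crux `stmt-MatrixMultiplication-0956`, route `NilCoxeterShadow`, lead cycle 2)

Helper file of line `birth`/`registered` (lands `--supports stmt-MatrixMultiplication-0956`). Writing
`b n := bR(T_{NC_n}) = algBorderRank (nilCoxeterTensor ℂ n)`, the crux `AThesis` asks for `δ > 0` with
`(n!)^(1+δ) ≤ b n` infinitely often, and the line's open stub `InductiveCosetGrowth` (stmt-0958) for a uniform
step `(n+1)^(1+δ) · b n ≤ b (n+1)`. The route's deciding theorem `closes` says qualitatively that `AThesis`
refutes `ω(ℂ) = 2`. This file makes the statement QUANTITATIVE and records the resulting window for `δ`: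

* `tensorRank_groupTensor_le_rpow_omega` — for every `ε > 0` there is `C` with
  `R(T_{ℂ[G]}) ≤ C · |G|^(ω/2 + ε)` for all finite groups `G` (Wedderburn blocks `∑ dᵢ² = |G|`,
  `R(⟨d,d,d⟩) ≤ C d^(ω+2ε)`, `dᵢ² ≤ |G|`; the `ω = 2` case is the landed support item
  `OmegaTwoGroupAlgebraRank`, stmt-0962);
* `two_add_two_mul_le_omega_of_io_growth` — if `(n!)^(1+δ) ≤ K · b n` for infinitely many `n` (some
  constant `K`), then `2 + 2δ ≤ ω(ℂ)`: `b n ≤ R(T_{ℂ[S_n]}) ≤ C (n!)^(ω/2+ε)` (degeneration transfer +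
  the above), so `(n!)^(1+δ-ω/2-ε) ≤ K·C` infinitely often, impossible for `1 + δ > ω/2` (`n! → ∞`);
* `two_add_two_mul_le_omega_of_aThesisWith`, `two_add_two_mul_le_omega_of_inductiveCosetGrowthWith` — the
  two instances (the uniform step accumulates to `(n!)^(1+δ) ≤ (n₀!)^(1+δ) · b n` for `n ≥ n₀`, so NO
  exponent is lost: stmt-0958 with exponent `δ` also forces `ω ≥ 2 + 2δ`);
* `aThesisWith_exponent_lt`, `inductiveCosetGrowthWith_exponent_lt` — with the tree's PROVED laser-method
  bound `ω(ℂ) < 2.3872` (`CoppersmithWinograd1990_sec7_omega_lt`): any admissible exponent satisfies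
  `δ < 0.1936`. So the crux and its engine live in the window `0 < δ < 0.1936`, and each is exactly as
  strong, as a statement about `ω`, as the lower bound `ω ≥ 2 + 2δ` it certifies.
-/

-- `Summit.<Summit>.<Problem>`: for the single-conjunct summit the duplicate component is mandated.
set_option linter.dupNamespace false

noncomputable section

namespace Summit.MatrixMultiplication.MatrixMultiplication.Theorems.AThesis

open scoped BigOperators
open Literature.Computability.AlgebraicComplexity
open Literature.RepresentationTheory.FiniteGroups
open Summit.MatrixMultiplication.MatrixMultiplication.Theses.NilCoxeterShadow

/-- **`R(T_{ℂ[G]}) ≤ C_ε · |G|^(ω/2 + ε)`** for every finite group `G` and every `ε > 0`: Wedderburn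
`ℂ[G] ≃ ∏ᵢ ℂ^{dᵢ×dᵢ}` with `∑ᵢ dᵢ² = |G|`, the block bound `R(T_{ℂ[G]}) ≤ ∑ᵢ R(⟨dᵢ,dᵢ,dᵢ⟩)`,
`R(⟨d,d,d⟩) ≤ C d^(ω+2ε) = C d² (d²)^((ω-2)/2+ε)` and `dᵢ² ≤ |G|` (`ω ≥ 2` keeps the exponent
non-negative). The case `ω = 2` is the route's support item `OmegaTwoGroupAlgebraRank`.
[cite: BurgisserClausenShokrollahi1997, §15.5 (proof of (15.11))] -/
theorem tensorRank_groupTensor_le_rpow_omega {ε : ℝ} (hε : 0 < ε) :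
    ∃ C : ℝ, 0 < C ∧ ∀ (G : Type) [Group G] [Fintype G] [DecidableEq G],
      (tensorRank (groupTensor ℂ G) : ℝ) ≤ C * (Fintype.card G : ℝ) ^ (omega ℂ / 2 + ε) := by
  obtain ⟨C, hC, hCa⟩ :=
    exists_tensorRank_matMulTensor_le_rpow ℂ (show (0 : ℝ) < 2 * ε by linarith)
  refine ⟨C, hC, fun G _ _ _ => ?_⟩
  obtain ⟨r, d, hd, ⟨φ⟩⟩ := exists_algEquiv_pi_matrix G
  have hsum : ∑ i, d i ^ 2 = Fintype.card G := by
    rw [sum_sq_blockDegrees_eq_card φ, Nat.card_eq_fintype_card]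
  have hblocks : tensorRank (groupTensor ℂ G) ≤
      ∑ i : Fin r, tensorRank (matMulTensor ℂ (d i) (d i) (d i)) :=
    Summit.MatrixMultiplication.MatrixMultiplication.Theorems.tensorRank_groupTensor_le_sum_blocks φ
  have hGpos : (0 : ℝ) < Fintype.card G := by exact_mod_cast Fintype.card_pos
  have hω2 : 2 ≤ omega ℂ := omega_two_le ℂ
  set θ : ℝ := (omega ℂ - 2) / 2 + ε with hθ
  have hθ0 : 0 ≤ θ := by rw [hθ]; linarith
  -- `dᵢ² ≤ |G|`
  have hdi : ∀ i, (d i : ℝ) ^ 2 ≤ Fintype.card G := fun i => by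
    have h : d i ^ 2 ≤ ∑ j, d j ^ 2 :=
      Finset.single_le_sum (fun j _ => Nat.zero_le (d j ^ 2)) (Finset.mem_univ i)
    rw [hsum] at h
    exact_mod_cast h
  -- each block: `R(⟨dᵢ,dᵢ,dᵢ⟩) ≤ C dᵢ^(ω+2ε) = C dᵢ² (dᵢ²)^θ ≤ C |G|^θ dᵢ²`
  have hblock : ∀ i, (tensorRank (matMulTensor ℂ (d i) (d i) (d i)) : ℝ) ≤
      C * (Fintype.card G : ℝ) ^ θ * (d i : ℝ) ^ 2 := fun i => by
    have h1 := hCa (d i) NeZero.one_le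
    have hdpos : (0 : ℝ) < d i := by exact_mod_cast Nat.pos_of_neZero (d i)
    have h2 : (d i : ℝ) ^ (omega ℂ + 2 * ε) = (d i : ℝ) ^ 2 * ((d i : ℝ) ^ 2) ^ θ := by
      rw [← Real.rpow_natCast (d i : ℝ) 2, ← Real.rpow_mul hdpos.le, ← Real.rpow_add hdpos]
      congr 1
      rw [hθ]
      push_cast
      ring
    have h3 : ((d i : ℝ) ^ 2) ^ θ ≤ (Fintype.card G : ℝ) ^ θ :=
      Real.rpow_le_rpow (by positivity) (hdi i) hθ0
    calc (tensorRank (matMulTensor ℂ (d i) (d i) (d i)) : ℝ)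
        ≤ C * (d i : ℝ) ^ (omega ℂ + 2 * ε) := h1
      _ = C * ((d i : ℝ) ^ 2 * ((d i : ℝ) ^ 2) ^ θ) := by rw [h2]
      _ ≤ C * ((d i : ℝ) ^ 2 * (Fintype.card G : ℝ) ^ θ) :=
        mul_le_mul_of_nonneg_left (mul_le_mul_of_nonneg_left h3 (by positivity)) hC.le
      _ = C * (Fintype.card G : ℝ) ^ θ * (d i : ℝ) ^ 2 := by ring
  have hsumR : ∑ i, (d i : ℝ) ^ 2 = Fintype.card G := by exact_mod_cast hsum
  have hexp : θ + 1 = omega ℂ / 2 + ε := by rw [hθ]; ring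
  calc (tensorRank (groupTensor ℂ G) : ℝ)
      ≤ ∑ i : Fin r, (tensorRank (matMulTensor ℂ (d i) (d i) (d i)) : ℝ) := by
        exact_mod_cast hblocks
    _ ≤ ∑ i : Fin r, C * (Fintype.card G : ℝ) ^ θ * (d i : ℝ) ^ 2 :=
        Finset.sum_le_sum fun i _ => hblock i
    _ = C * (Fintype.card G : ℝ) ^ θ * ∑ i : Fin r, (d i : ℝ) ^ 2 := by rw [Finset.mul_sum]
    _ = C * (Fintype.card G : ℝ) ^ θ * (Fintype.card G : ℝ) := by rw [hsumR]
    _ = C * (Fintype.card G : ℝ) ^ (omega ℂ / 2 + ε) := by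
        have hpow : (Fintype.card G : ℝ) ^ (omega ℂ / 2 + ε) =
            (Fintype.card G : ℝ) ^ θ * (Fintype.card G : ℝ) := by
          rw [← hexp, Real.rpow_add hGpos θ 1, Real.rpow_one]
        rw [hpow]; ring

/-- **`R(T_{ℂ[S_n]}) ≤ C_ε · (n!)^(ω/2 + ε)`** (`|S_n| = n!`). [folklore] -/
theorem tensorRank_groupTensor_perm_le_rpow_omega {ε : ℝ} (hε : 0 < ε) :
    ∃ C : ℝ, 0 < C ∧ ∀ n : ℕ, (tensorRank (groupTensor ℂ (Equiv.Perm (Fin n))) : ℝ) ≤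
      C * (n.factorial : ℝ) ^ (omega ℂ / 2 + ε) := by
  obtain ⟨C, hC, h⟩ := tensorRank_groupTensor_le_rpow_omega hε
  refine ⟨C, hC, fun n => ?_⟩
  have := h (Equiv.Perm (Fin n))
  rwa [Fintype.card_perm, Fintype.card_fin] at this

/-- **`bR(T_{NC_n}) ≤ C_ε · (n!)^(ω/2 + ε)`**: degeneration transfer `bR(T_{NC_n}) ≤ R(T_{ℂ[S_n]})`
(`algBorderRank_nilCoxeterTensor_le`) and the Wedderburn bound. [folklore] -/
theorem algBorderRank_nilCoxeterTensor_le_rpow_omega {ε : ℝ} (hε : 0 < ε) :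
    ∃ C : ℝ, 0 < C ∧ ∀ n : ℕ, (algBorderRank (nilCoxeterTensor ℂ n) : ℝ) ≤
      C * (n.factorial : ℝ) ^ (omega ℂ / 2 + ε) := by
  obtain ⟨C, hC, h⟩ := tensorRank_groupTensor_perm_le_rpow_omega hε
  refine ⟨C, hC, fun n => le_trans ?_ (h n)⟩
  exact_mod_cast algBorderRank_nilCoxeterTensor_le ℂ n

/-- **The window lemma.** If for some constant `K` the inequality `(n!)^(1+δ) ≤ K · bR(T_{NC_n})` holds
for infinitely many `n`, then `2 + 2δ ≤ ω(ℂ)`: otherwise, with `ε = (1 + δ - ω/2)/2 > 0`,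
`(n!)^(1+δ) ≤ K · C (n!)^(ω/2+ε)` gives `(n!)^ε ≤ K · C` for infinitely many `n`, absurd since `n! ≥ n`.
[folklore] -/
theorem two_add_two_mul_le_omega_of_io_growth {δ K : ℝ}
    (h : ∀ n₀ : ℕ, ∃ n : ℕ, n₀ ≤ n ∧
      (n.factorial : ℝ) ^ (1 + δ) ≤ K * (algBorderRank (nilCoxeterTensor ℂ n) : ℝ)) :
    2 + 2 * δ ≤ omega ℂ := by
  by_contra hlt
  rw [not_le] at hlt
  set ε : ℝ := (1 + δ - omega ℂ / 2) / 2 with hε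
  have hε0 : 0 < ε := by rw [hε]; linarith
  obtain ⟨C, hC, hCn⟩ := algBorderRank_nilCoxeterTensor_le_rpow_omega hε0
  -- the constant `M = max (K C) 1` is exceeded by `(n!)^ε` for large `n`
  set M : ℝ := max (K * C) 1 with hM
  have hM0 : 0 < M := lt_of_lt_of_le one_pos (le_max_right _ _)
  obtain ⟨N, hN⟩ := exists_nat_gt (M ^ (1 / ε))
  obtain ⟨n, hNn, hn⟩ := h N
  have hfpos : (0 : ℝ) < (n.factorial : ℝ) := by exact_mod_cast n.factorial_pos
  -- `(n!)^(1+δ) ≤ K C (n!)^(ω/2+ε)` and `1 + δ = ε + (ω/2 + ε)`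
  have h1 : (n.factorial : ℝ) ^ (1 + δ) ≤ K * C * (n.factorial : ℝ) ^ (omega ℂ / 2 + ε) := by
    calc (n.factorial : ℝ) ^ (1 + δ) ≤ K * (algBorderRank (nilCoxeterTensor ℂ n) : ℝ) := hn
      _ ≤ K * C * (n.factorial : ℝ) ^ (omega ℂ / 2 + ε) := by
          by_cases hK : 0 ≤ K
          · calc K * (algBorderRank (nilCoxeterTensor ℂ n) : ℝ)
                ≤ K * (C * (n.factorial : ℝ) ^ (omega ℂ / 2 + ε)) :=
                  mul_le_mul_of_nonneg_left (hCn n) hK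
              _ = K * C * (n.factorial : ℝ) ^ (omega ℂ / 2 + ε) := by ring
          · -- `K < 0`: the left side is `≤ 0 <` the right side... but the hypothesis then forces
            -- `(n!)^(1+δ) ≤ 0`, impossible; we derive the inequality from that contradiction.
            exfalso
            have hb : (0 : ℝ) ≤ (algBorderRank (nilCoxeterTensor ℂ n) : ℝ) := Nat.cast_nonneg _
            have : K * (algBorderRank (nilCoxeterTensor ℂ n) : ℝ) ≤ 0 :=
              mul_nonpos_of_nonpos_of_nonneg (le_of_lt (not_le.mp hK)) hb
            have hpos : (0 : ℝ) < (n.factorial : ℝ) ^ (1 + δ) := Real.rpow_pos_of_pos hfpos _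
            linarith
  have hsplit : (1 + δ) = ε + (omega ℂ / 2 + ε) := by rw [hε]; ring
  rw [hsplit, Real.rpow_add hfpos] at h1
  have h2 : (n.factorial : ℝ) ^ ε ≤ K * C :=
    le_of_mul_le_mul_right h1 (Real.rpow_pos_of_pos hfpos _)
  have h3 : (n.factorial : ℝ) ^ ε ≤ M := h2.trans (le_max_left _ _)
  -- but `n! ≥ n ≥ N > M^(1/ε)`, so `(n!)^ε > M`
  have h4 : M < (N : ℝ) ^ ε := by
    have hε1 : (1 / ε) * ε = 1 := by field_simp
    have : (M ^ (1 / ε)) ^ ε = M := by rw [← Real.rpow_mul hM0.le, hε1, Real.rpow_one]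
    calc M = (M ^ (1 / ε)) ^ ε := this.symm
      _ < (N : ℝ) ^ ε := Real.rpow_lt_rpow (Real.rpow_nonneg hM0.le _) hN hε0
  have h5 : (N : ℝ) ^ ε ≤ (n.factorial : ℝ) ^ ε := by
    refine Real.rpow_le_rpow (Nat.cast_nonneg _) ?_ hε0.le
    exact_mod_cast hNn.trans n.self_le_factorial
  linarith

/-- **`AThesis` with exponent `δ` forces `ω(ℂ) ≥ 2 + 2δ`** (the case `K = 1` of the window lemma):
the quantitative form of the route's deciding theorem `closes`. [folklore] -/
theorem two_add_two_mul_le_omega_of_aThesisWith {δ : ℝ}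
    (h : ∀ n₀ : ℕ, ∃ n : ℕ, n₀ ≤ n ∧
      (n.factorial : ℝ) ^ (1 + δ) ≤ (algBorderRank (nilCoxeterTensor ℂ n) : ℝ)) :
    2 + 2 * δ ≤ omega ℂ := by
  refine two_add_two_mul_le_omega_of_io_growth (K := 1) fun n₀ => ?_
  obtain ⟨n, hn, h'⟩ := h n₀
  exact ⟨n, hn, by rwa [one_mul]⟩

/-- **`InductiveCosetGrowth` with exponent `δ` forces `ω(ℂ) ≥ 2 + 2δ`, with NO loss of exponent**:
the uniform step from `n₀` on accumulates to `(n!)^(1+δ) ≤ (n₀!)^(1+δ) · bR(T_{NC_n})` for all `n ≥ n₀`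
(induction, using only `1 ≤ bR(T_{NC_{n₀}})`), which is the window lemma with `K = (n₀!)^(1+δ)`.
[folklore] -/
theorem two_add_two_mul_le_omega_of_inductiveCosetGrowthWith {δ : ℝ} {n₀ : ℕ}
    (hstep : ∀ n : ℕ, n₀ ≤ n → ((n : ℝ) + 1) ^ (1 + δ) * (algBorderRank (nilCoxeterTensor ℂ n) : ℝ) ≤
      (algBorderRank (nilCoxeterTensor ℂ (n + 1)) : ℝ)) :
    2 + 2 * δ ≤ omega ℂ := by
  set b : ℕ → ℝ := fun n => (algBorderRank (nilCoxeterTensor ℂ n) : ℝ) with hb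
  set K : ℝ := ((n₀.factorial : ℕ) : ℝ) ^ (1 + δ) with hK
  have hK0 : 0 ≤ K := Real.rpow_nonneg (Nat.cast_nonneg _) _
  have hbase : 1 ≤ b n₀ := by
    simp only [hb]
    exact_mod_cast one_le_algBorderRank_nilCoxeterTensor n₀
  -- accumulated growth along the tower (as in `exists_superpolynomial_of_growth`)
  have hacc : ∀ k : ℕ, (((n₀ + k).factorial : ℕ) : ℝ) ^ (1 + δ) ≤ K * b (n₀ + k) := by
    intro k
    induction k with
    | zero =>
      simp only [Nat.add_zero]
      calc ((n₀.factorial : ℕ) : ℝ) ^ (1 + δ) = K * 1 := (mul_one _).symm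
        _ ≤ K * b n₀ := mul_le_mul_of_nonneg_left hbase hK0
    | succ k ih =>
      have hs := hstep (n₀ + k) (Nat.le_add_right _ _)
      have hfac : (((n₀ + (k + 1)).factorial : ℕ) : ℝ) =
          (((n₀ + k : ℕ) : ℝ) + 1) * (((n₀ + k).factorial : ℕ) : ℝ) := by
        rw [← Nat.add_assoc, Nat.factorial_succ]
        push_cast
        ring
      have hpos1 : (0 : ℝ) ≤ ((n₀ + k : ℕ) : ℝ) + 1 := by positivity
      have hpos2 : (0 : ℝ) ≤ (((n₀ + k).factorial : ℕ) : ℝ) := Nat.cast_nonneg _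
      rw [hfac, Real.mul_rpow hpos1 hpos2]
      calc (((n₀ + k : ℕ) : ℝ) + 1) ^ (1 + δ) * (((n₀ + k).factorial : ℕ) : ℝ) ^ (1 + δ)
          ≤ (((n₀ + k : ℕ) : ℝ) + 1) ^ (1 + δ) * (K * b (n₀ + k)) :=
            mul_le_mul_of_nonneg_left ih (Real.rpow_nonneg hpos1 _)
        _ = K * ((((n₀ + k : ℕ) : ℝ) + 1) ^ (1 + δ) * b (n₀ + k)) := by ring
        _ ≤ K * b (n₀ + k + 1) := mul_le_mul_of_nonneg_left hs hK0
        _ = K * b (n₀ + (k + 1)) := by rw [Nat.add_assoc]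
  refine two_add_two_mul_le_omega_of_io_growth (K := K) fun N => ?_
  obtain ⟨k, hk⟩ : ∃ k : ℕ, max N n₀ = n₀ + k := Nat.exists_eq_add_of_le (le_max_right _ _)
  refine ⟨n₀ + k, ?_, ?_⟩
  · calc N ≤ max N n₀ := le_max_left _ _
      _ = n₀ + k := hk
  · have := hacc k
    simpa only [Nat.cast_id] using this

/-- **The crux refines `closes` quantitatively**: `AThesis → ∃ δ > 0, 2 + 2δ ≤ ω(ℂ)` (in particular
`ω(ℂ) ≠ 2`). [folklore] -/
theorem exists_two_add_two_mul_le_omega_of_aThesis :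
    AThesis → ∃ δ : ℝ, 0 < δ ∧ 2 + 2 * δ ≤ Literature.Computability.AlgebraicComplexity.omega ℂ := by
  intro h
  have h' : ∃ δ : ℝ, 0 < δ ∧ ∀ n₀ : ℕ, ∃ n : ℕ, n₀ ≤ n ∧
      (n.factorial : ℝ) ^ (1 + δ) ≤ (algBorderRank (nilCoxeterTensor ℂ n) : ℝ) := h
  obtain ⟨δ, hδ, hio⟩ := h'
  exact ⟨δ, hδ, two_add_two_mul_le_omega_of_aThesisWith hio⟩

/-- **The window for the crux's exponent**: with the laser-method bound `ω(ℂ) < 2.3872`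
(Coppersmith–Winograd 1990 §7, PROVED in the tree as `CoppersmithWinograd1990_sec7_omega_lt`), any `δ` for
which `(n!)^(1+δ) ≤ bR(T_{NC_n})` holds infinitely often satisfies `δ < 0.1936`.
[cite: CoppersmithWinograd1990, §7 (last display)] -/
theorem aThesisWith_exponent_lt {δ : ℝ}
    (h : ∀ n₀ : ℕ, ∃ n : ℕ, n₀ ≤ n ∧
      (n.factorial : ℝ) ^ (1 + δ) ≤ (algBorderRank (nilCoxeterTensor ℂ n) : ℝ)) :
    δ < 0.1936 := by
  have h1 := two_add_two_mul_le_omega_of_aThesisWith h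
  have h2 := CoppersmithWinograd1990_sec7_omega_lt
  linarith

/-- **The window for the engine's exponent**: any `δ` admitting a uniform step
`(n+1)^(1+δ) · bR(T_{NC_n}) ≤ bR(T_{NC_{n+1}})` from some `n₀` on satisfies `δ < 0.1936`.
[cite: CoppersmithWinograd1990, §7 (last display)] -/
theorem inductiveCosetGrowthWith_exponent_lt {δ : ℝ} {n₀ : ℕ}
    (hstep : ∀ n : ℕ, n₀ ≤ n → ((n : ℝ) + 1) ^ (1 + δ) * (algBorderRank (nilCoxeterTensor ℂ n) : ℝ) ≤
      (algBorderRank (nilCoxeterTensor ℂ (n + 1)) : ℝ)) :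
    δ < 0.1936 := by
  have h1 := two_add_two_mul_le_omega_of_inductiveCosetGrowthWith hstep
  have h2 := CoppersmithWinograd1990_sec7_omega_lt
  linarith

end Summit.MatrixMultiplication.MatrixMultiplication.Theorems.AThesis

end
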